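import Literature.NumberTheory.DiophantineGeometry.RothNearbyRationals
import Literature.NumberTheory.DiophantineApproximation.SPartPolynomialValuesProofs

/-!
# The `p`-adic Roth theorem over `ℚ` (Ridout) — II. Local estimates and the product formula

Second file towards the `p`-adic Thue–Siegel–Roth theorem for integers over `ℚ` (Ridout 1958
[Ridout1958]; Bombieri–Gubler [BombieriGubler2006] Thm. 6.2.3, 6.2.5–6.2.6), on top of the
tree's proof of Roth's theorem after Schmidt [Schmidt1980] (`DiophantineGeometry/Roth*`). Here:
the estimates of Steps III–IV of Bombieri–Gubler's proof (6.2.9 / §6.4: *"the upper bound"* by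
Taylor's formula at each place and *"the Liouville lower bound"* by the product formula), in the
form used in `RidoutAssembly.lean`, i.e. for `K = ℚ`, integer polynomials, diagonal targets
`(θ_v, …, θ_v)` and rational points.

* `Ridout.norm_aeval_le_one`, `Ridout.norm_root_le_one` — integer polynomials take values of
  norm `≤ 1` at points of norm `≤ 1` of an ultrametric field; roots of monic integer polynomials
  have norm `≤ 1` (algebraic integers are `v`-adic integers).
* `Ridout.norm_aeval_le_of_indexGe` — **the ultrametric upper bound** (B–G Step III at a finite
  place): if `P ∈ ℤ[X₁..X_m]` has index `≥ w` at `(θ,…,θ)` (`‖θ‖ ≤ 1`) and `‖ρ_h − θ‖ ≤ δ_h`, then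
  `‖P(ρ)‖ ≤ Φ` for any bound `Φ` of the monomials `Π δ_h^{i_h}` over `i ≤ r`, `wt i ≥ w`
  (Taylor's formula `Roth.taylor_formula` and the ultrametric inequality — no binomial losses).
* `Ridout.abs_aeval_le_of_indexGe_zero` — **the archimedean upper bound at the target `0`**
  (`α_∞ = ∞` after B–G 6.2.5): index `≥ w` at the origin kills the monomials of weight `< w`, so
  `|P(ρ)| ≤ Π(r_h+1) · |P| · Φ` for any bound `Φ` of `Π |ρ_h|^{i_h}` over `i ≤ r`, `wt i ≥ w`.
* `Ridout.prod_rpow_le_exp` — the weight bookkeeping `Π_h q_h^{-s i_h} ≤ exp(-s W Σ i_h/r_h)` when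
  `W ≤ r_h log q_h` (Schmidt's (8.4), B–G Step V).
* `Ridout.exists_int_aeval_eq`, `Ridout.aeval_ratCast` — clearing denominators over `ℚ`
  (`q₁^{r₁}⋯q_m^{r_m} P(p/q) ∈ ℤ`) and transport of `ℚ`-values to any field of characteristic `0`.
* `Ridout.sPart_dvd`, `Ridout.one_le_abs_mul_prod_norm` — **the product formula lower bound**
  (B–G Step IV over `ℚ`): for a non-zero integer `z` and a finite set of primes `S`,
  `1 ≤ |z| · Π_{p ∈ S} |z|_p`.

## References

* [BombieriGubler2006] E. Bombieri, W. Gubler, *Heights in Diophantine Geometry*, CUP 2006,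
  6.2.9 (Steps III–V), §6.4.
* [Schmidt1980] W. M. Schmidt, *Diophantine Approximation*, LNM 785, Springer 1980, Ch. V §8.
* [Ridout1958] D. Ridout, *The `p`-adic generalization of the Thue–Siegel–Roth theorem*,
  Mathematika 5 (1958) 40–48.
-/

noncomputable section

open MvPolynomial Finset Real
open scoped Polynomial

namespace Literature.NumberTheory.DiophantineApproximation

namespace Ridout

open Literature.NumberTheory.DiophantineGeometry.Roth

/-! ### Integer polynomials at `v`-adic integers -/

section Ultrametric

variable {K : Type*} [NormedField K] [IsUltrametricDist K]

/-- An integer polynomial takes values of norm `≤ 1` at points of norm `≤ 1` of an ultrametric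
normed field. [folklore] -/
theorem norm_aeval_le_one {σ : Type*} [Fintype σ] (P : MvPolynomial σ ℤ) (a : σ → K)
    (ha : ∀ s, ‖a s‖ ≤ 1) :
    ‖aeval a P‖ ≤ 1 := by
  classical
  rw [MvPolynomial.aeval_def, MvPolynomial.eval₂_eq']
  refine IsUltrametricDist.norm_sum_le_of_forall_le_of_nonneg zero_le_one fun j _ => ?_
  rw [norm_mul, norm_prod]
  refine mul_le_one₀ ?_ (by positivity) (Finset.prod_le_one (fun _ _ => by positivity) ?_)
  · simpa using IsUltrametricDist.norm_intCast_le_one K (P.coeff j)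
  · intro s _
    rw [norm_pow]
    exact pow_le_one₀ (norm_nonneg _) (ha s)

/-- A univariate integer polynomial takes values of norm `≤ 1` at points of norm `≤ 1` of an
ultrametric normed field. [folklore] -/
theorem norm_polynomial_aeval_le_one (Q : ℤ[X]) (θ : K) (hθ : ‖θ‖ ≤ 1) :
    ‖Polynomial.aeval θ Q‖ ≤ 1 := by
  rw [Polynomial.aeval_eq_sum_range]
  refine IsUltrametricDist.norm_sum_le_of_forall_le_of_nonneg zero_le_one fun k _ => ?_
  rw [Algebra.smul_def, norm_mul, norm_pow]
  refine mul_le_one₀ ?_ (by positivity) (pow_le_one₀ (norm_nonneg _) hθ)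
  simpa using IsUltrametricDist.norm_intCast_le_one K (Q.coeff k)

/-- **Algebraic integers are `v`-adic integers**: a root, in an ultrametric normed field, of a
monic polynomial with integer coefficients has norm `≤ 1` (if `‖θ‖ > 1` then `‖θ^d‖` exceeds the
norm of every other term of `Q(θ) = 0`). [folklore] -/
theorem norm_root_le_one (Q : ℤ[X]) (hQ : Q.Monic) (θ : K) (hθ : Polynomial.aeval θ Q = 0) :
    ‖θ‖ ≤ 1 := by
  by_contra hgt
  rw [not_le] at hgt
  have hθ0 : θ ≠ 0 := by
    rintro rfl; norm_num at hgt
  set d := Q.natDegree with hd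
  -- `θ^d = -(Σ_{k<d} q_k θ^k)`
  have hsum : Polynomial.aeval θ Q = ∑ k ∈ range (d + 1), (Q.coeff k : K) * θ ^ k := by
    rw [Polynomial.aeval_eq_sum_range]
    simp [Algebra.smul_def, ← hd]
  have hsplit : θ ^ d = -∑ k ∈ range d, (Q.coeff k : K) * θ ^ k := by
    rw [hθ, Finset.sum_range_succ] at hsum
    have hlead : (Q.coeff d : K) = 1 := by
      rw [hd, ← Polynomial.leadingCoeff, hQ.leadingCoeff]; simp
    rw [hlead, one_mul] at hsum
    exact eq_neg_of_add_eq_zero_right hsum.symm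
  -- every term of the right-hand side has norm `≤ ‖θ‖^{d-1} < ‖θ‖^d`
  have hbound : ‖∑ k ∈ range d, (Q.coeff k : K) * θ ^ k‖ ≤ ‖θ‖ ^ d / ‖θ‖ := by
    refine IsUltrametricDist.norm_sum_le_of_forall_le_of_nonneg (by positivity) fun k hk => ?_
    rw [norm_mul, norm_pow]
    have hk' : k + 1 ≤ d := mem_range.mp hk
    calc ‖(Q.coeff k : K)‖ * ‖θ‖ ^ k ≤ 1 * ‖θ‖ ^ k := by
          gcongr; simpa using IsUltrametricDist.norm_intCast_le_one K (Q.coeff k)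
      _ ≤ ‖θ‖ ^ (d - 1) := by
          rw [one_mul]; exact pow_le_pow_right₀ hgt.le (by omega)
      _ = ‖θ‖ ^ d / ‖θ‖ := by
          rw [eq_div_iff (norm_ne_zero_iff.mpr hθ0), ← pow_succ]
          congr 1; omega
  have hnorm : ‖θ‖ ^ d ≤ ‖θ‖ ^ d / ‖θ‖ := by
    calc ‖θ‖ ^ d = ‖θ ^ d‖ := (norm_pow _ _).symm
      _ = ‖∑ k ∈ range d, (Q.coeff k : K) * θ ^ k‖ := by rw [hsplit, norm_neg]
      _ ≤ ‖θ‖ ^ d / ‖θ‖ := hbound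
  have hpos : 0 < ‖θ‖ ^ d := by positivity
  rw [le_div_iff₀ (by positivity)] at hnorm
  nlinarith

/-! ### The ultrametric upper bound (B–G Step III at a finite place) -/

/-- **The ultrametric upper bound.** Let `P ∈ ℤ[X₀,…,X_{m-1}]` have `deg_{X_h} P ≤ r_h` and index
`≥ w` at `(θ,…,θ)` with respect to `r`, where `‖θ‖ ≤ 1` in an ultrametric normed field, and let
`‖ρ_h − θ‖ ≤ δ_h` (`δ_h ≥ 0`). If `Φ ≥ 0` bounds `Π_h δ_h^{i_h}` for every multi-index `i ≤ r` of
weight `Σ i_h/r_h ≥ w`, then `‖P(ρ)‖ ≤ Φ`. Proof: Taylor's formula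
`P(ρ) = Σ_i P_i(θ,…,θ) Π_h (ρ_h − θ)^{i_h}` (`Roth.taylor_formula`), the terms with `wt i < w`
vanish, `‖P_i(θ,…,θ)‖ ≤ 1` (integer coefficients, `‖θ‖ ≤ 1`), and the ultrametric inequality.
[cite: BombieriGubler2006, 6.2.9 Step III and §6.4 (non-archimedean place)] -/
theorem norm_aeval_le_of_indexGe {m : ℕ} (P : MvPolynomial (Fin m) ℤ) (r : Fin m → ℕ)
    (hdeg : ∀ h, P.degreeOf h ≤ r h) (θ : K) (hθ : ‖θ‖ ≤ 1) (w : ℝ)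
    (hind : IndexGe P (fun _ : Fin m => θ) r w) (ρ : Fin m → K) (δ : Fin m → ℝ)
    (hδ : ∀ h, ‖ρ h - θ‖ ≤ δ h) (Φ : ℝ) (hΦ0 : 0 ≤ Φ)
    (hΦ : ∀ i : Fin m →₀ ℕ, (∀ h, i h ≤ r h) → w ≤ wt r i → ∏ h, δ h ^ (i h) ≤ Φ) :
    ‖aeval ρ P‖ ≤ Φ := by
  classical
  have hδ0 : ∀ h, 0 ≤ δ h := fun h => (norm_nonneg _).trans (hδ h)
  set T : Finset (Fin m →₀ ℕ) := Finset.Iic (Finsupp.equivFunOnFinite.symm r) with hT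
  have hTmem : ∀ i, hasseD i P ≠ 0 → i ∈ T := fun i hi => mem_Iic_of_hasseD_ne_zero r hdeg hi
  rw [taylor_formula_of_subset (fun _ : Fin m => θ) ρ P hTmem]
  refine IsUltrametricDist.norm_sum_le_of_forall_le_of_nonneg hΦ0 fun i hi => ?_
  have hir : ∀ h, i h ≤ r h := by
    intro h
    have := (Finset.mem_Iic.mp hi) h
    simpa using this
  by_cases hwt : wt r i < w
  · rw [hind i hwt, zero_mul, norm_zero]; exact hΦ0
  · rw [not_lt] at hwt
    rw [norm_mul, norm_prod]
    calc ‖aeval (fun _ : Fin m => θ) (hasseD i P)‖ * ∏ h, ‖(ρ h - θ) ^ (i h)‖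
        ≤ 1 * ∏ h, δ h ^ (i h) := by
          apply mul_le_mul (norm_aeval_le_one _ _ fun _ => hθ) _ (by positivity) zero_le_one
          refine Finset.prod_le_prod (fun h _ => norm_nonneg _) fun h _ => ?_
          rw [norm_pow]
          exact pow_le_pow_left₀ (norm_nonneg _) (hδ h) _
      _ ≤ Φ := by rw [one_mul]; exact hΦ i hir hwt

end Ultrametric

/-! ### The archimedean upper bound at the target `0` -/

/-- At the origin, `P_i(0,…,0)` is the coefficient of `X^i`. [folklore] -/
theorem aeval_zero_hasseD {m : ℕ} {A : Type*} [CommRing A] (i : Fin m →₀ ℕ)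
    (P : MvPolynomial (Fin m) ℤ) :
    aeval (fun _ : Fin m => (0 : A)) (hasseD i P) = ((coeff i P : ℤ) : A) := by
  classical
  have h0 : (fun _ : Fin m => (0 : A)) = 0 := rfl
  rw [h0, MvPolynomial.aeval_zero]
  show algebraMap ℤ A (coeff 0 (hasseD i P)) = _
  rw [coeff_hasseD]
  have h1 : (i.prod fun a b => (i a).choose b) = 1 := Finset.prod_eq_one fun a _ => by simp
  simp [h1]

/-- **The archimedean upper bound at the target `0`.** Let `P ∈ ℤ[X₀,…,X_{m-1}]` have
`deg_{X_h} P ≤ r_h` and index `≥ w` at the origin with respect to `r` (i.e. its monomials have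
weight `Σ i_h/r_h ≥ w`), and let `|ρ_h| ≤ δ_h`. If `Φ ≥ 0` bounds `Π_h δ_h^{i_h}` for every `i ≤ r`
of weight `≥ w`, then `|P(ρ)| ≤ Π_h (r_h+1) · |P| · Φ` (at most `Π(r_h+1)` monomials, each of size
`≤ |P| Φ`). This is Step III at the place `∞` for the target `α_∞ = ∞` moved to `0`
(B–G 6.2.5–6.2.6). [cite: BombieriGubler2006, 6.2.9 Step III with 6.2.5 (archimedean place)] -/
theorem abs_aeval_le_of_indexGe_zero {m : ℕ} (P : MvPolynomial (Fin m) ℤ) (r : Fin m → ℕ)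
    (hdeg : ∀ h, P.degreeOf h ≤ r h) (w : ℝ) (hind : IndexGe P (fun _ : Fin m => (0 : ℝ)) r w)
    (ρ : Fin m → ℝ) (δ : Fin m → ℝ) (hδ : ∀ h, |ρ h| ≤ δ h) (Φ : ℝ) (hΦ0 : 0 ≤ Φ)
    (hΦ : ∀ i : Fin m →₀ ℕ, (∀ h, i h ≤ r h) → w ≤ wt r i → ∏ h, δ h ^ (i h) ≤ Φ) :
    |aeval ρ P| ≤ (∏ h, ((r h : ℝ) + 1)) * height P * Φ := by
  classical
  rw [MvPolynomial.aeval_def, MvPolynomial.eval₂_eq']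
  refine (Finset.abs_sum_le_sum_abs _ _).trans ?_
  have hterm : ∀ j ∈ P.support, |algebraMap ℤ ℝ (P.coeff j) * ∏ h, ρ h ^ (j h)| ≤
      (height P : ℝ) * Φ := by
    intro j hj
    have hjr : ∀ h, j h ≤ r h := fun h => (monomial_le_degreeOf h hj).trans (hdeg h)
    by_cases hwt : wt r j < w
    · have h0 : P.coeff j = 0 := by
        have := hind j hwt
        rw [aeval_zero_hasseD] at this
        exact_mod_cast this
      rw [h0, map_zero, zero_mul, abs_zero]; positivity
    · rw [not_lt] at hwt
      rw [abs_mul, abs_prod]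
      apply mul_le_mul (by simpa using abs_coeff_le_height P j) _ (by positivity) (by positivity)
      refine le_trans ?_ (hΦ j hjr hwt)
      refine Finset.prod_le_prod (fun h _ => by positivity) fun h _ => ?_
      rw [abs_pow]
      exact pow_le_pow_left₀ (abs_nonneg _) (hδ h) _
  refine (Finset.sum_le_sum hterm).trans ?_
  rw [Finset.sum_const, nsmul_eq_mul, mul_assoc]
  apply mul_le_mul_of_nonneg_right _ (by positivity)
  exact_mod_cast card_support_le_of_degreeOf_le P r hdeg

/-! ### Weights (Schmidt's (8.4), B–G Step V) -/

/-- **Weight bookkeeping**: if `0 < q_h` and `W ≤ r_h log q_h` for all `h`, then for `s ≥ 0` and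
every multi-index `i`, `Π_h (q_h^{-s})^{i_h} ≤ exp(-s · W · Σ_h i_h/r_h)`.
[cite: Schmidt1980, Ch. V §8 (8.4), §11] -/
theorem prod_rpow_le_exp {m : ℕ} (r : Fin m → ℕ) (hr : ∀ h, 0 < r h) (q : Fin m → ℝ)
    (hq : ∀ h, 0 < q h) (W : ℝ) (hW : ∀ h, W ≤ r h * Real.log (q h)) {s : ℝ} (hs : 0 ≤ s)
    (i : Fin m →₀ ℕ) :
    ∏ h, ((q h) ^ (-s)) ^ (i h) ≤ Real.exp (-(s * W * wt r i)) := by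
  unfold wt
  rw [mul_sum, ← sum_neg_distrib, Real.exp_sum]
  refine Finset.prod_le_prod (fun h _ => by have := hq h; positivity) fun h _ => ?_
  rw [← Real.rpow_natCast, ← Real.rpow_mul (hq h).le, Real.rpow_def_of_pos (hq h)]
  apply Real.exp_le_exp.mpr
  have hrh : (0 : ℝ) < r h := by exact_mod_cast hr h
  have h1 : s * W * ((i h : ℝ) / r h) ≤ s * (r h * Real.log (q h)) * ((i h : ℝ) / r h) := by
    apply mul_le_mul_of_nonneg_right _ (by positivity)
    exact mul_le_mul_of_nonneg_left (hW h) hs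
  have h2 : s * (r h * Real.log (q h)) * ((i h : ℝ) / r h) = Real.log (q h) * (s * i h) := by
    field_simp
  rw [h2] at h1
  have : Real.log (q h) * (-s * (i h : ℝ)) = -(Real.log (q h) * (s * i h)) := by ring
  rw [this]
  linarith

/-! ### Clearing denominators and transport of rational values -/

/-- Clearing denominators over `ℚ`: if `deg_{X_h} P ≤ r_h` then
`q₀^{r₀}⋯q_{m-1}^{r_{m-1}} · P(p₀/q₀,…) ∈ ℤ` (the tree's `Roth.exists_int_aeval_mul_prod_pow` is the
same statement read in `ℝ`). [cite: Schmidt1980, Ch. V §8 (p. 127)] -/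
theorem exists_int_aeval_eq {m : ℕ} (P : MvPolynomial (Fin m) ℤ) (r : Fin m → ℕ)
    (hr : ∀ h, P.degreeOf h ≤ r h) (p : Fin m → ℤ) (q : Fin m → ℕ) (hq : ∀ h, 0 < q h) :
    ∃ N : ℤ, aeval (fun h => (p h : ℚ) / q h) P * ∏ h, (q h : ℚ) ^ (r h) = N := by
  classical
  refine ⟨∑ j ∈ P.support, P.coeff j * ∏ h, (p h) ^ (j h) * (q h : ℤ) ^ (r h - j h), ?_⟩
  rw [MvPolynomial.aeval_def, MvPolynomial.eval₂_eq', Finset.sum_mul]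
  push_cast
  apply Finset.sum_congr rfl
  intro j hj
  rw [mul_assoc, ← Finset.prod_mul_distrib]
  congr 1
  apply Finset.prod_congr rfl
  intro h _
  have hjr : j h ≤ r h := (monomial_le_degreeOf h hj).trans (hr h)
  have hq0 : (q h : ℚ) ≠ 0 := by exact_mod_cast (hq h).ne'
  rw [div_pow, ← pow_sub_mul_pow (q h : ℚ) hjr]
  field_simp

/-- Transport of rational values: for an integer polynomial and a rational point, the value in
any field of characteristic `0` is the image of the value in `ℚ`. [folklore] -/
theorem aeval_ratCast {m : ℕ} {L : Type*} [Field L] [CharZero L] (P : MvPolynomial (Fin m) ℤ)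
    (x : Fin m → ℚ) : aeval (fun h => ((x h : ℚ) : L)) P = ((aeval x P : ℚ) : L) := by
  rw [MvPolynomial.aeval_def, MvPolynomial.aeval_def, ← Rat.coe_castHom,
    MvPolynomial.eval₂_comp_left (Rat.castHom L)]
  have : (Rat.castHom L).comp (algebraMap ℤ ℚ) = algebraMap ℤ L := RingHom.ext_int _ _
  rw [this]
  rfl

/-! ### The product formula lower bound (B–G Step IV over `ℚ`) -/

/-- The `S`-part `Π_{p ∈ S} p^{v_p(z)}` of an integer divides it. [folklore] -/
theorem sPart_dvd (S : Finset Nat.Primes) (z : ℤ) :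
    (∏ p ∈ S, ((p : ℕ) : ℤ) ^ padicValInt p z) ∣ z := by
  classical
  refine Finset.prod_dvd_of_coprime ?_ fun p _ => ?_
  · intro p _ p' _ hpp'
    have hne : (p : ℕ) ≠ p' := fun h => hpp' (Nat.Primes.coe_nat_injective h)
    have := (Nat.coprime_pow_primes (padicValInt p z) (padicValInt p' z) p.2 p'.2 hne).isCoprime
    simpa [Function.onFun] using this
  · have h := pow_padicValNat_dvd (p := (p : ℕ)) (n := z.natAbs)
    have h' : ((((p : ℕ) ^ padicValNat p z.natAbs : ℕ)) : ℤ) ∣ z := Int.natCast_dvd.mpr h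
    simpa [padicValInt] using h'

/-- **The product formula lower bound over `ℚ`**: for a non-zero integer `z` and a finite set
of primes `S`, `1 ≤ |z| · Π_{p ∈ S} |z|_p` (the omitted places contribute factors `≤ 1` to
`Π_v |z|_v = 1`; equivalently, the `S`-part of `z` is at most `|z|`). This is the "Liouville
lower bound" of Step IV. [cite: BombieriGubler2006, 6.2.9 Step IV and §6.4 (product formula)] -/
theorem one_le_abs_mul_prod_norm (S : Finset Nat.Primes) {z : ℤ} (hz : z ≠ 0) :
    1 ≤ |(z : ℝ)| * ∏ p ∈ S, ‖(z : @PadicAlgCl (p : ℕ) ⟨p.2⟩)‖ := by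
  rw [prod_norm_intCast_padicAlgCl S hz]
  have hpos : (0 : ℝ) < ∏ p ∈ S, ((p : ℕ) : ℝ) ^ padicValInt p z :=
    Finset.prod_pos fun p _ => pow_pos (by exact_mod_cast p.2.pos) _
  rw [← div_eq_mul_inv, le_div_iff₀ hpos, one_mul]
  have h1 : (∏ p ∈ S, ((p : ℕ) : ℤ) ^ padicValInt p z : ℤ) ≤ |z| :=
    Int.le_of_dvd (abs_pos.mpr hz) ((sPart_dvd S z).trans (dvd_abs z z |>.mpr dvd_rfl))
  have h2 : ((∏ p ∈ S, ((p : ℕ) : ℤ) ^ padicValInt p z : ℤ) : ℝ) ≤ ((|z| : ℤ) : ℝ) := by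
    exact_mod_cast h1
  push_cast at h2
  exact h2

end Ridout

end Literature.NumberTheory.DiophantineApproximation

end
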